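import Summits.HodgeConjecture.HodgeConjecture.Theorems.F0P3bPPartOperators
import Mathlib.LinearAlgebra.Eigenspace.Basic
import HarnessLib

/-!
# FLOOR-0 P3b «ENGINE local packets» — infrastructure II: the `(𝔤, K)`-submodule of a `(𝔤, K)`-module of `U(α, β)`
# generated by a null core and its `z₀`-grading (classification-free «lowest `K`-type» generation lemma)

Cell hodgecm-mathlib, FLOOR 0, crux item H413 = stmt-HodgeConjecture-24833; sub-line
`Cruxes/H413/Lines/F0_EngineLocalPackets.lean` (F0P3b-plan, ed. 1 808dda7d).  Helper file (light definitions `grade`, `gen` + lemmas), author F0P3-p01 (g2); the common engine behind the closers of the registered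
stubs T6a (purity), T6b (`dim ≤ 1`), T6c (rigidity).  NO unitarity, NO admissibility, NO classification of the unitary
dual: only `ad_compat`, irreducibility and `z₀` (★ `F0P3bPPartOperators`).

THE ARGUMENT ([BorelWallach2000, II §4.1–4.2]; [Rogawski1990, §15.2]; the «lowest `K`-type» mechanism of
[VoganZuckerman1984, §5–6] in its most elementary form).  Fix `μ` with `μ² = −1`, `N = pOp μ`, `P = pOp (−μ)`.  A NULL
CORE is a `𝔨`- and `K`-stable complex subspace `E` of `N`-null vectors (e.g. the null weight space `T_w(μ)` of `F0P3bPNullIrreducible`, or the span of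
the values of a closed cochain of type `δ`, `μ = δi`).  Graded pieces `G₀ = E`, `G_{n+1} = Σ_s P(x_s) G_n`: they are
`𝔨`-stable, `K`-stable, `N(𝔭) G_{n+1} ⊆ G_n`, `N(𝔭) G₀ = 0`, so `gen = ⨆_n G_n` is an `IsGKSubmodule`; if `E` has
`z₀`-weight `w` then `G_n ⊆ eigenspace(ρz₀, w + nμ)`.  (The irreducible case — `gen = ⊤`, spectrum `{w + nμ}`,
`eigenspace(w) = E` — is `F0P3bPNullIrreducible`.)

HONEST LABEL: HC_CM is proved only modulo the printed citations until rung 0 closes; this file discharges none of them.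
-/

-- Mathlib idiom (as in `GKModules`, `GKCohomology`, the `Upq*` files and the Lines file): commutator bracket on `Module.End`
attribute [local instance 100] LieRing.ofAssociativeRing

set_option autoImplicit false
set_option linter.dupNamespace false

noncomputable section

namespace Summit.HodgeConjecture.HodgeConjecture.Cruxes.H413.F0P3bPNullGeneration

open Literature.Algebra.Lie Literature.Algebra.Lie.ChevalleyEilenberg
open Literature.NumberTheory.Automorphic
open Literature.RepresentationTheory.BorelWallach2000
open Literature.RepresentationTheory.KonnoKonno2007 Literature.RepresentationTheory.KonnoKonno2007.RealDualPair
open Literature.RepresentationTheory.KonnoKonno2007.RealDualPair.UForm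
open Summit.HodgeConjecture.HodgeConjecture.Cruxes.H413.F0P3bPPartOperators

variable {α β : Type} [Fintype α] [DecidableEq α] [Fintype β] [DecidableEq β]

/-! ## §3 Null cores, the graded pieces `G_n` and the generated `(𝔤, K)`-submodule -/

section Generation

variable {V : Type} [AddCommGroup V] [Module ℂ V]
  (ρK : Representation ℂ (uFormGroup α β).maximalCompact V)
  (ρ𝔤 : (uFormGroup α β).lie →ₗ⁅ℝ⁆ Module.End ℂ V)

/-! A NULL CORE (for the nullity parameter `μ`) is a complex subspace `E` of `pOp μ`-null vectors (`ρ x_s e + μ ρ(J x_s) e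
= 0`, the line's `IsPNull`) which is `𝔨`-stable and `K`-stable — e.g. the null weight space `T_w(μ)` of `F0P3bPNullIrreducible`,
or the span of the values of a closed `(𝔤, K)`-1-cochain of type `δ`, `μ = δ i` (★ T3j).  The three properties are carried as
the explicit hypotheses `hEn` (null), `hEk` (`𝔨`-stable), `hEK` (`K`-stable) below. -/

/-- **The graded pieces** `G₀ = E`, `G_{n+1} = Σ_s pOp (−μ) (x_s) · G_n` ("`S^n(𝔭^δ) · E`").
[cite: BorelWallach2000, II §4.1] -/
def grade (μ : ℂ) (E : Submodule ℂ V) : ℕ → Submodule ℂ V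
  | 0 => E
  | n + 1 => ⨆ s : (α × β) × Fin 2, (grade μ E n).map (pOp ρ𝔤 (-μ) (upqPBasis s))

/-- **The generated subspace** `⨆_n G_n`. [cite: BorelWallach2000, II §4.1] -/
def gen (μ : ℂ) (E : Submodule ℂ V) : Submodule ℂ V := ⨆ n : ℕ, grade ρ𝔤 μ E n

variable {ρK ρ𝔤}

/-- `G₀ = E`. [folklore] -/
theorem grade_zero (μ : ℂ) (E : Submodule ℂ V) : grade ρ𝔤 μ E 0 = E := rfl

/-- `G_{n+1} = ⨆_s pOp (−μ) x_s · G_n`. [folklore] -/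
theorem grade_succ (μ : ℂ) (E : Submodule ℂ V) (n : ℕ) :
    grade ρ𝔤 μ E (n + 1) = ⨆ s : (α × β) × Fin 2, (grade ρ𝔤 μ E n).map (pOp ρ𝔤 (-μ) (upqPBasis s)) := rfl

/-- `G_n ≤ gen`. [folklore] -/
theorem grade_le_gen (μ : ℂ) (E : Submodule ℂ V) (n : ℕ) : grade ρ𝔤 μ E n ≤ gen ρ𝔤 μ E :=
  le_iSup (fun n => grade ρ𝔤 μ E n) n

/-- `E ≤ gen`. [folklore] -/
theorem le_gen (μ : ℂ) (E : Submodule ℂ V) : E ≤ gen ρ𝔤 μ E := grade_le_gen μ E 0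

/-- The raising operators map `G_n` into `G_{n+1}` (frame version). [cite: BorelWallach2000, II §4.1] -/
theorem pOp_upqPBasis_mem_grade_succ (μ : ℂ) (E : Submodule ℂ V) (n : ℕ) (s : (α × β) × Fin 2) {v : V}
    (hv : v ∈ grade ρ𝔤 μ E n) : pOp ρ𝔤 (-μ) (upqPBasis s) v ∈ grade ρ𝔤 μ E (n + 1) := by
  rw [grade_succ]
  exact Submodule.mem_iSup_of_mem s (Submodule.mem_map_of_mem hv)

/-- The raising operator `pOp (−μ) X`, `X ∈ 𝔭`, maps `G_n` into `G_{n+1}`. [cite: BorelWallach2000, II §4.1] -/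
theorem pOp_mem_grade_succ (μ : ℂ) (E : Submodule ℂ V) (n : ℕ) (X : (uFormGroup α β).lie) (hX : X ∈ pPart α β)
    {v : V} (hv : v ∈ grade ρ𝔤 μ E n) : pOp ρ𝔤 (-μ) X v ∈ grade ρ𝔤 μ E (n + 1) := by
  obtain ⟨c, rfl⟩ := exists_sum_upqPBasis_of_mem_pPart X hX
  rw [pOp_sum_smul_apply]
  exact Submodule.sum_mem _ fun s _ => Submodule.smul_mem _ _ (pOp_upqPBasis_mem_grade_succ μ E n s hv)

/-- The nullity operator `pOp μ X`, `X ∈ 𝔭`, kills a null core. [cite: BorelWallach2000, II §4.2 (3)] -/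
theorem pOp_eq_zero_of_mem_core {μ : ℂ} {E : Submodule ℂ V}
    (hEn : ∀ e ∈ E, ∀ s : (α × β) × Fin 2, pOp ρ𝔤 μ (upqPBasis s) e = 0) (X : (uFormGroup α β).lie)
    (hX : X ∈ pPart α β) {e : V} (he : e ∈ E) : pOp ρ𝔤 μ X e = 0 := by
  obtain ⟨c, rfl⟩ := exists_sum_upqPBasis_of_mem_pPart X hX
  rw [pOp_sum_smul_apply]
  exact Finset.sum_eq_zero fun s _ => by rw [hEn e he s, smul_zero]

/-- **`G_n` is `𝔨`-stable** (`[ρW, P(x_s)] = P(⁅W, x_s⁆)`, `⁅W, x_s⁆ ∈ 𝔭`). [cite: BorelWallach2000, II §4.1] -/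
theorem lie_mem_grade {μ : ℂ} {E : Submodule ℂ V} (hEk : ∀ W ∈ (uFormGroup α β).kInLie, ∀ e ∈ E, ρ𝔤 W e ∈ E)
    (W : (uFormGroup α β).lie) (hW : W ∈ (uFormGroup α β).kInLie) :
    ∀ (n : ℕ) {v : V}, v ∈ grade ρ𝔤 μ E n → ρ𝔤 W v ∈ grade ρ𝔤 μ E n := by
  intro n
  induction n with
  | zero => exact fun hv => hEk W hW _ hv
  | succ n ih =>
    intro v hv
    rw [grade_succ] at hv
    refine Submodule.iSup_induction _ (motive := fun v => ρ𝔤 W v ∈ grade ρ𝔤 μ E (n + 1)) hv ?_ ?_ ?_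
    · rintro s _ ⟨m, hm, rfl⟩
      rw [lieK_pOp_apply ρ𝔤 _ W hW]
      exact Submodule.add_mem _ (pOp_upqPBasis_mem_grade_succ μ E n s (ih hm))
        (pOp_mem_grade_succ μ E n _ (lie_mem_pPart W hW _ (upqPBasis_mem_pPart s)) hm)
    · rw [map_zero]; exact Submodule.zero_mem _
    · intro x y hx hy
      rw [map_add]; exact Submodule.add_mem _ hx hy

/-- **`G_n` is `K`-stable** (`ρK k P(x_s) ρK k⁻¹ = P(Ad k x_s)`, `Ad k x_s ∈ 𝔭`). [cite: BorelWallach2000, I §5.1 (1)] -/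
theorem K_mem_grade
    (hV : ∀ (k : (uFormGroup α β).maximalCompact) (X : (uFormGroup α β).lie), ρK k ∘ₗ ρ𝔤 X ∘ₗ ρK k⁻¹ =
      ρ𝔤 ((uFormGroup α β).Ad (Subgroup.inclusion (uFormGroup α β).maximalCompact_le_carrier k) X))
    {μ : ℂ} {E : Submodule ℂ V} (hEK : ∀ (k : (uFormGroup α β).maximalCompact), ∀ e ∈ E, ρK k e ∈ E)
    (k : (uFormGroup α β).maximalCompact) :
    ∀ (n : ℕ) {v : V}, v ∈ grade ρ𝔤 μ E n → ρK k v ∈ grade ρ𝔤 μ E n := by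
  intro n
  induction n with
  | zero => exact fun hv => hEK k _ hv
  | succ n ih =>
    intro v hv
    rw [grade_succ] at hv
    refine Submodule.iSup_induction _ (motive := fun v => ρK k v ∈ grade ρ𝔤 μ E (n + 1)) hv ?_ ?_ ?_
    · rintro s _ ⟨m, hm, rfl⟩
      rw [K_pOp_apply ρK ρ𝔤 hV]
      exact pOp_mem_grade_succ μ E n _ (Ad_mem_pPart k _ (upqPBasis_mem_pPart s)) (ih hm)
    · rw [map_zero]; exact Submodule.zero_mem _
    · intro x y hx hy
      rw [map_add]; exact Submodule.add_mem _ hx hy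

/-- One step of the nullity recursion: if `P(x_s) N(X) G_n ⊆ G_n` then `N(X) G_{n+1} ⊆ G_n`
(`N P m = P N m + [N, P] m`, `[N, P] ∈ ρ(𝔨) + μρ(𝔨)`). [cite: BorelWallach2000, II §4.1] -/
theorem pOp_mem_grade_of_succ {μ : ℂ} {E : Submodule ℂ V} (hEk : ∀ W ∈ (uFormGroup α β).kInLie, ∀ e ∈ E, ρ𝔤 W e ∈ E) (n : ℕ)
    (H : ∀ {m : V}, m ∈ grade ρ𝔤 μ E n → ∀ X ∈ pPart α β, ∀ s : (α × β) × Fin 2,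
      pOp ρ𝔤 (-μ) (upqPBasis s) (pOp ρ𝔤 μ X m) ∈ grade ρ𝔤 μ E n)
    {v : V} (hv : v ∈ grade ρ𝔤 μ E (n + 1)) (X : (uFormGroup α β).lie) (hX : X ∈ pPart α β) :
    pOp ρ𝔤 μ X v ∈ grade ρ𝔤 μ E n := by
  rw [grade_succ] at hv
  refine Submodule.iSup_induction _ (motive := fun v => pOp ρ𝔤 μ X v ∈ grade ρ𝔤 μ E n) hv ?_ ?_ ?_
  · rintro s _ ⟨m, hm, rfl⟩
    have hc := pOp_comm_mem ρ𝔤 (grade ρ𝔤 μ E n) (fun W hW u hu => lie_mem_grade hEk W hW n hu) μ (-μ) X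
      (upqPBasis s) hX (upqPBasis_mem_pPart s) m hm
    have e : pOp ρ𝔤 μ X (pOp ρ𝔤 (-μ) (upqPBasis s) m) =
        (pOp ρ𝔤 μ X (pOp ρ𝔤 (-μ) (upqPBasis s) m) - pOp ρ𝔤 (-μ) (upqPBasis s) (pOp ρ𝔤 μ X m)) +
          pOp ρ𝔤 (-μ) (upqPBasis s) (pOp ρ𝔤 μ X m) := (sub_add_cancel _ _).symm
    rw [e]
    exact Submodule.add_mem _ hc (H hm X hX s)
  · rw [map_zero]; exact Submodule.zero_mem _
  · intro x y hx hy
    rw [map_add]; exact Submodule.add_mem _ hx hy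

/-- **`N(𝔭) G_{n+1} ⊆ G_n`** for a null core (and `N(𝔭) G₀ = 0`, `pOp_eq_zero_of_mem_core`).
[cite: BorelWallach2000, II §4.1] -/
theorem pOp_mem_grade {μ : ℂ} {E : Submodule ℂ V} (hEn : ∀ e ∈ E, ∀ s : (α × β) × Fin 2, pOp ρ𝔤 μ (upqPBasis s) e = 0)
    (hEk : ∀ W ∈ (uFormGroup α β).kInLie, ∀ e ∈ E, ρ𝔤 W e ∈ E) :
    ∀ (n : ℕ) {v : V}, v ∈ grade ρ𝔤 μ E (n + 1) → ∀ X ∈ pPart α β, pOp ρ𝔤 μ X v ∈ grade ρ𝔤 μ E n := by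
  intro n
  induction n with
  | zero =>
    intro v hv X hX
    refine pOp_mem_grade_of_succ hEk 0 (fun {m} hm Y hY s => ?_) hv X hX
    rw [grade_zero] at hm
    rw [pOp_eq_zero_of_mem_core hEn Y hY hm, map_zero]
    exact Submodule.zero_mem _
  | succ n ih =>
    intro v hv X hX
    exact pOp_mem_grade_of_succ hEk (n + 1)
      (fun {m} hm Y hY s => pOp_upqPBasis_mem_grade_succ μ E n s (ih hm Y hY)) hv X hX

/-- **The `z₀`-weights of the graded pieces**: if `E` has weight `w` then `G_n ⊆ eigenspace(ρz₀, w + nμ)`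
(`μ² = −1`). [cite: BorelWallach2000, II §4.1] -/
theorem z0_apply_of_mem_grade {μ : ℂ} (hμ : μ * μ = -1) {E : Submodule ℂ V} {w : ℂ}
    (hw : ∀ e ∈ E, ρ𝔤 (upqZ0 α β) e = w • e) :
    ∀ (n : ℕ) {v : V}, v ∈ grade ρ𝔤 μ E n → ρ𝔤 (upqZ0 α β) v = (w + n * μ) • v := by
  intro n
  induction n with
  | zero =>
    intro v hv
    rw [Nat.cast_zero, zero_mul, add_zero]
    exact hw v hv
  | succ n ih =>
    intro v hv
    rw [grade_succ] at hv
    refine Submodule.iSup_induction _ (motive := fun v => ρ𝔤 (upqZ0 α β) v = (w + ↑(n + 1) * μ) • v) hv ?_ ?_ ?_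
    · rintro s _ ⟨m, hm, rfl⟩
      have hc : (-μ) * (-μ) = -1 := by rw [neg_mul_neg, hμ]
      rw [z0_pOp_apply ρ𝔤 hc _ (upqPBasis_mem_pPart s), ih hm, map_smul, neg_smul, sub_neg_eq_add, ← add_smul]
      congr 1
      push_cast
      ring
    · rw [map_zero, smul_zero]
    · intro x y hx hy
      rw [map_add, hx, hy, smul_add]

/-- `G_n ≤ eigenspace(ρz₀, w + nμ)`. [cite: BorelWallach2000, II §4.1] -/
theorem grade_le_eigenspace {μ : ℂ} (hμ : μ * μ = -1) {E : Submodule ℂ V} {w : ℂ}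
    (hw : ∀ e ∈ E, ρ𝔤 (upqZ0 α β) e = w • e) (n : ℕ) :
    grade ρ𝔤 μ E n ≤ Module.End.eigenspace (ρ𝔤 (upqZ0 α β)) (w + n * μ) :=
  fun _ hv => Module.End.mem_eigenspace_iff.2 (z0_apply_of_mem_grade hμ hw n hv)

/-- **`gen ≤ ⨆_n eigenspace(ρz₀, w + nμ)`**: the `z₀`-spectrum of the generated subspace.
[cite: BorelWallach2000, II §4.1] -/
theorem gen_le_iSup_eigenspace {μ : ℂ} (hμ : μ * μ = -1) {E : Submodule ℂ V} {w : ℂ}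
    (hw : ∀ e ∈ E, ρ𝔤 (upqZ0 α β) e = w • e) :
    gen ρ𝔤 μ E ≤ ⨆ n : ℕ, Module.End.eigenspace (ρ𝔤 (upqZ0 α β)) (w + n * μ) :=
  iSup_mono fun n => grade_le_eigenspace hμ hw n

/-- **The generated subspace of a null core is a `(𝔤, K)`-submodule** (`ρ x_s = ½ (P + N)(x_s)`,
`𝔤 = 𝔨 + Σ_s ℝ x_s`). [cite: BorelWallach2000, II §4.1; I §5.1] -/
theorem isGKSubmodule_gen
    (hV : ∀ (k : (uFormGroup α β).maximalCompact) (X : (uFormGroup α β).lie), ρK k ∘ₗ ρ𝔤 X ∘ₗ ρK k⁻¹ =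
      ρ𝔤 ((uFormGroup α β).Ad (Subgroup.inclusion (uFormGroup α β).maximalCompact_le_carrier k) X))
    {μ : ℂ} {E : Submodule ℂ V} (hEn : ∀ e ∈ E, ∀ s : (α × β) × Fin 2, pOp ρ𝔤 μ (upqPBasis s) e = 0)
    (hEk : ∀ W ∈ (uFormGroup α β).kInLie, ∀ e ∈ E, ρ𝔤 W e ∈ E)
    (hEK : ∀ (k : (uFormGroup α β).maximalCompact), ∀ e ∈ E, ρK k e ∈ E) : IsGKSubmodule ρK ρ𝔤 (gen ρ𝔤 μ E) := by
  have hgen : ∀ {v : V}, v ∈ gen ρ𝔤 μ E → ∀ P : V → Prop, (∀ n, ∀ u ∈ grade ρ𝔤 μ E n, P u) → P 0 →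
      (∀ x y, P x → P y → P (x + y)) → P v :=
    fun hv P hmem h0 hadd => Submodule.iSup_induction _ (motive := P) hv hmem h0 hadd
  refine ⟨fun k v hv => ?_, fun X v hv => ?_⟩
  · refine hgen hv (fun v => ρK k v ∈ gen ρ𝔤 μ E) (fun n u hu => grade_le_gen μ E n (K_mem_grade hV hEK k n hu))
      (by rw [map_zero]; exact Submodule.zero_mem _) fun x y hx hy => ?_
    rw [map_add]; exact Submodule.add_mem _ hx hy
  · obtain ⟨W, hW, c, rfl⟩ := upq_exists_kInLie_add_sum_upqPBasis X
    -- `𝔨`-part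
    have hk : ρ𝔤 W v ∈ gen ρ𝔤 μ E :=
      hgen hv (fun v => ρ𝔤 W v ∈ gen ρ𝔤 μ E) (fun n u hu => grade_le_gen μ E n (lie_mem_grade hEk W hW n hu))
        (by rw [map_zero]; exact Submodule.zero_mem _) fun x y hx hy => by
          rw [map_add]; exact Submodule.add_mem _ hx hy
    -- frame part: `ρ x_s = ½ (P + N)(x_s)`
    have hP : ∀ s, pOp ρ𝔤 (-μ) (upqPBasis s) v ∈ gen ρ𝔤 μ E := fun s =>
      hgen hv (fun v => pOp ρ𝔤 (-μ) (upqPBasis s) v ∈ gen ρ𝔤 μ E)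
        (fun n u hu => grade_le_gen μ E (n + 1) (pOp_upqPBasis_mem_grade_succ μ E n s hu))
        (by rw [map_zero]; exact Submodule.zero_mem _) fun x y hx hy => by
          rw [map_add]; exact Submodule.add_mem _ hx hy
    have hN : ∀ s, pOp ρ𝔤 μ (upqPBasis s) v ∈ gen ρ𝔤 μ E := fun s =>
      hgen hv (fun v => pOp ρ𝔤 μ (upqPBasis s) v ∈ gen ρ𝔤 μ E)
        (fun n u hu => by
          cases n with
          | zero =>
            rw [grade_zero] at hu
            rw [hEn u hu s]; exact Submodule.zero_mem _
          | succ n => exact grade_le_gen μ E n (pOp_mem_grade hEn hEk n hu _ (upqPBasis_mem_pPart s)))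
        (by rw [map_zero]; exact Submodule.zero_mem _) fun x y hx hy => by
          rw [map_add]; exact Submodule.add_mem _ hx hy
    have hx : ∀ s, ρ𝔤 (upqPBasis s) v = (2⁻¹ : ℂ) • (pOp ρ𝔤 (-μ) (upqPBasis s) v + pOp ρ𝔤 μ (upqPBasis s) v) := by
      intro s
      rw [pOp_neg_add_pOp, smul_smul, inv_mul_cancel₀ (two_ne_zero), one_smul]
    rw [map_add, LinearMap.add_apply, map_sum, LinearMap.sum_apply]
    refine Submodule.add_mem _ hk (Submodule.sum_mem _ fun s _ => ?_)
    rw [map_smul, LinearMap.smul_apply, hx, ← Complex.coe_smul]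
    exact Submodule.smul_mem _ _ (Submodule.smul_mem _ _ (Submodule.add_mem _ (hP s) (hN s)))

end Generation

end Summit.HodgeConjecture.HodgeConjecture.Cruxes.H413.F0P3bPNullGeneration

end
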